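import Literature.MathematicalPhysics.QuantumLattice.TorusSectorPressureTypeBound
import Literature.MathematicalPhysics.QuantumLattice.TorusSectorPartitionFnTwoScaleTiling
import Literature.MathematicalPhysics.QuantumLattice.HubbardGroundStateDoublonBound
import HarnessLib

/-!
# The type-class (C2) pressure floor holds on EVERY large torus: corner cut, crude border floor,
# and the thermodynamic limit along any `Ls → ∞`

Family `hubbard` (topic `MathematicalPhysics/QuantumLattice`); continuation of `TorusSectorPressureTypeBound`
(hubbard-thermal's certificate C2: certified open-box canonical partition functions `0 < z_s ≤ Re Z_β(H^open_{a×b}; s)`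
on a finite set `S` of box sectors and a balanced base type `m` give the LOWER bound
`W = (q log q − Σ_s m_s log m_s + Σ_s m_s log z_s)/(q a b)` on the canonical sector pressure of the torus).
There the thermodynamic-limit statement (`eventually_typeFreeEntropy_mul_sq_le_log_partitionFn`) carries the
hypothesis `hbox`: the tori are BOX-COMPATIBLE (`Ls j = K_x a = K_y b`, `K_x K_y = R q`,
`halfRectN n (Ls j) = R A₀`) — so every word read through it binds only the torus limits taken along such
special side sequences, a sub-class of the thermal convention of record (canonical sector Gibbs torus limits
along ANY `Ls → ∞`), and does not discharge the `∀ Ls` hypotheses of the readers downstream (KT dictionary,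
one-band box seam, pressure-floor entropy rows). This file removes `hbox`:

* §1 `exp_neg_le_partitionFn_spinSector_twoGraph` — the crude floor
  `exp(−β (U+U')⁺ min(p,q)) ≤ Re Z_β(H_{G,G'}(t,U,t',U'); p, q)` for ANY two bond sets on any finite ordered
  site set (Peierls' inequality for one occupation-basis vector: the hopping has no diagonal entries
  (`creation_mul_annihilation_apply_self_eq_zero`, `hamiltonian_apply_diag`), and a configuration of the sector
  `(p,q)` has at most `min(p,q)` doubly occupied sites).
* §2 THE CORNER CUT (`partitionFn_rowCut_single_le`, `partitionFn_corner_le`): for any two bond sets on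
  `Fin (K₁ + h) ×ₗ Fin (K₂ + w)`, cutting off the last `h` rows and then (after the coordinate swap) the last `w`
  columns, with no penalty (induced bond sets, `partitionFn_twoGraph_sector_cut_sum_of_induced`) and ONE split of
  the particle numbers each time:
  `Re Z(inner K₁×K₂; c,d) · Re Z(side strip; q) · Re Z(top strip; r) ≤ Re Z(whole; c+q₁+r₁, d+q₂+r₂)`.
* §3 `coeff_pow_mul_exp_le_partitionFn_rectTorus_corner` — on the torus `(K_x a + h) × (K_y b + w)`
  (`K_x, K_y, h, w ≥ 1`) the inner rectangle's blocks are OPEN `a × b` boxes (offset lemmas of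
  `TorusSectorPartitionFnTwoScaleTiling`), so for every `P ∈ ℝ[ℕ×ℕ]` with `0 ≤ P ≤ Re Z_β(H^open_{a×b})`
  coefficientwise: `(P^{K_x K_y})(c,d) · e^{−βU⁺ min q} · e^{−βU⁺ min r} ≤ Re Z_β(H^torus; c+q₁+r₁, d+q₂+r₂)`
  for all border sectors `q ≤ w K_x a`, `r ≤ h (K_y b + w)` — the border strips absorb the particles the type
  does not place, at the crude floor.
* §4 `InfVolFermionState.eventually_typeFreeEntropy_mul_sq_le_log_partitionFn_allTori` — the C2 floor in the
  thermodynamic limit along EVERY `Ls → ∞`: type density `2A₀/(q a b) = n ∈ [0, 2]` and the data of the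
  box-compatible theorem, NO `hbox`: `∀ ε > 0, ∀ᶠ j, (W − ε)(Ls j)² ≤ log Re Z_β(sectorHamiltonianTT' t t' U n (Ls j))`
  (inner rectangle `K_x a × K_y b` with `q ∣ K_x`, `K_x a, K_y b ∈ [L − qa, L − 1] × [L − b, L − 1]`; the
  `O(L)` border sites and the `|S| log(L²+1)` type count are absorbed per volume) — exactly the pressure-floor
  INPUT shape `hW` of `HubbardThermalAxisWindow` / `TorusSectorGibbsEntropyRowPressureInput`.

Everything is PROVED; no definition, no named fact.

## Mathlib / tree search

REUSED: `ThermodynamicLimit.partitionFn_twoGraph_sector_cut_sum_of_induced` (`SectorPartitionFnCutSum`),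
`ThermodynamicLimit.partitionFn_spinSector_twoGraph_comap_rectSwap`, `nonempty_spinConfig`,
`partitionFn_spinSector_re_nonneg` (`TorusSectorPartitionFnTiling`), `coeff_prod_le_partitionFn_blocks`,
`coeff_pow_nonneg_of_nonneg` (`TorusSectorPartitionFnMixtureTiling`),
`comap_fermionRectTorusGraph_eq_rectBoxGraph_of_offset`, `comap_fermionRectTorusDiagGraph_eq_rectBoxDiagGraph_of_offset`
(`TorusSectorPartitionFnTwoScaleTiling`), `le_coeff_pow_of_type`, `typeEntropy_sub_le_log_multinomial`,
`InfVolFermionState.typeEntropy_smul` (`TorusSectorPressureTypeBound`), `partitionFn_sectorHamiltonianTT'_eq_spinSector`,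
`partitionFn_spinSector_hubbardTorusTT'_eq_rect` (`TorusSectorGibbsOpenBoxBound`), `rectCastAdd`, `rectNatAdd`,
`rectSwap`, `card_rectSites` (`HubbardRectangularTorus`), `sum_numberOp_mul_numberOp_eq_diagonal`, `doublyOccupied`
(`HubbardAtomicLimit`), `creation_mul_annihilation_apply_self_eq_zero` (`HubbardGroundStateDoublonBound`),
`IsHermitian.sum_exp_neg_mul_rayleigh_le_partitionFn_submatrix` (`PeierlsOrthonormalFamily`).
`lean search 'allTori|typeFreeEntropy'`: only the box-built versions (2026-08-27).

## References

* D. Ruelle, *Statistical Mechanics: Rigorous Results* (1969), §3.3 eqs. (3.11)–(3.18) (boxes inside a larger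
  box, corridor/border terms absorbed per volume), §2.5–2.6 (Peierls). [cite: Ruelle1969, §3.3 (3.11)–(3.18)]
* R. B. Israel, *Convexity in the Theory of Lattice Gases* (1979), Lemma II.3.1. [cite: Israel1979, Lemma II.3.1]
* T. M. Cover, J. A. Thomas, *Elements of Information Theory* (2006), Thm. 11.1.3 (method of types).
  [cite: CoverThomas2006, Theorem 11.1.3]
* J. P. F. LeBlanc et al., Phys. Rev. X 5 (2015) 041041, eq. (1) (the `t–t'` Hubbard model). [cite: LeBlancEtAl2015, eq. (1)]
-/

noncomputable section

namespace Literature.MathematicalPhysics.QuantumLattice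

open Matrix Finset HubbardWave0 ThermodynamicLimit LiebThm1 AddMonoidAlgebra Literature.Probability.LatticeModels
open _root_.Filter
open scoped _root_.Topology ComplexOrder BigOperators

/-! ### §1 The crude floor: Peierls' inequality for one occupation-basis vector -/

section Floor

variable {Λ : Type*} [LinearOrder Λ] [Fintype Λ]

/-- **Diagonal entries of the Hubbard Hamiltonian**: `(H_G(t,U))_{ss} = U · #(doubly occupied sites of s)` for
every bond set `G` (the hopping part is off-diagonal in the occupation basis). [cite: LeBlancEtAl2015, eq. (1)] -/
theorem hamiltonian_apply_diag (G : SimpleGraph Λ) [DecidableRel G.Adj] (t U : ℝ) (s : Finset (Orb Λ)) :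
    hamiltonian G t U s s = (U : ℂ) * ((doublyOccupied s).card : ℂ) := by
  have hhop : (∑ x : Λ, ∑ y : Λ, ∑ σ : Fin 2,
      (if G.Adj x y then creation (orb x σ) * annihilation (orb y σ) else
        (0 : Matrix (Finset (Orb Λ)) (Finset (Orb Λ)) ℂ))) s s = 0 := by
    rw [Matrix.sum_apply, Finset.sum_eq_zero]
    intro x _
    rw [Matrix.sum_apply, Finset.sum_eq_zero]
    intro y _
    rw [Matrix.sum_apply, Finset.sum_eq_zero]
    intro σ _
    split_ifs with hxy
    · exact creation_mul_annihilation_apply_self_eq_zero (fun h => G.ne_of_adj hxy (orb_inj.1 h).1) _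
    · rfl
  unfold hamiltonian
  rw [Matrix.add_apply, Matrix.smul_apply, Matrix.smul_apply, hhop, smul_zero, zero_add,
    sum_numberOp_mul_numberOp_eq_diagonal, Matrix.diagonal_apply_eq, smul_eq_mul]

/-- In the spin sector `(p, q)` a configuration has at most `min p q` doubly occupied sites (copy of
`card_doublyOccupied_le_min` of `HubbardTTPrimeOpenBoxPartitionFnCouplingTransport`, kept private to keep the
import list short). [cite: Ruelle1969, §3.3 (3.11)–(3.18)] -/
private theorem card_doublyOccupied_le_min'' {p q : ℕ} {s : Finset (Orb Λ)} (hs : spinConfig p q s) :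
    (doublyOccupied s).card ≤ min p q := by
  unfold doublyOccupied
  exact le_min (hs.1 ▸ card_le_card inter_subset_left) (hs.2 ▸ card_le_card inter_subset_right)

/-- **The crude floor on a canonical partition function.** For ANY two bond sets `G, G'` on a finite ordered
site set, real `t, U, t', U'`, `β ≥ 0` and a nonempty spin sector `(p, q)` (`p, q ≤ |Λ|`):
`exp(−β · max(U+U', 0) · min(p,q)) ≤ Re Z_β(H_G(t,U) + H_{G'}(t',U'); p, q)` — Peierls' inequality for the single
occupation-basis vector of a configuration of the sector, whose energy is `(U+U') · #doubly-occupied ≤ (U+U')⁺ min(p,q)`.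
[cite: Ruelle1969, §3.3 (3.11)–(3.18)] [cite: Israel1979, Lemma II.3.1] -/
theorem exp_neg_le_partitionFn_spinSector_twoGraph (G G' : SimpleGraph Λ) [DecidableRel G.Adj]
    [DecidableRel G'.Adj] (t U t' U' : ℝ) {β : ℝ} (hβ : 0 ≤ β) {p q : ℕ} (hp : p ≤ Fintype.card Λ)
    (hq : q ≤ Fintype.card Λ) :
    Real.exp (-(β * max (U + U') 0 * ((min p q : ℕ) : ℝ))) ≤
      (partitionFn β (spinSectorHamiltonian p q (hamiltonian G t U + hamiltonian G' t' U'))).re := by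
  classical
  obtain ⟨⟨s, hs⟩⟩ := nonempty_spinConfig (Λ := Λ) hp hq
  have hH : (hamiltonian G t U + hamiltonian G' t' U').IsHermitian :=
    (hamiltonian_isHermitian G t U).add (hamiltonian_isHermitian G' t' U')
  set v : Unit → Fock (Orb Λ) := fun _ => Pi.single s 1 with hv
  have hon : ∀ i j, star (v i) ⬝ᵥ v j = if i = j then 1 else 0 := by
    intro i j
    rw [if_pos (Subsingleton.elim i j), hv]
    simp
  have hsupp : ∀ i x, ¬ spinConfig (Λ := Λ) p q x → v i x = 0 := by
    intro i x hx
    rw [hv]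
    simp only
    rw [Pi.single_apply, if_neg]
    rintro rfl
    exact hx hs
  have h := hH.sum_exp_neg_mul_rayleigh_le_partitionFn_submatrix (spinConfig (Λ := Λ) p q) β hon hsupp
  rw [Fintype.sum_unique] at h
  have hdiag : (star (v default) ⬝ᵥ ((hamiltonian G t U + hamiltonian G' t' U') *ᵥ v default)).re =
      (U + U') * ((doublyOccupied s).card : ℝ) := by
    rw [hv]
    simp only
    rw [Literature.Computability.AlgebraicComplexity.star_single_dotProduct_mulVec_single, Matrix.add_apply,
      hamiltonian_apply_diag, hamiltonian_apply_diag]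
    have e : (U : ℂ) * ((doublyOccupied s).card : ℂ) + (U' : ℂ) * ((doublyOccupied s).card : ℂ) =
        (((U + U') * ((doublyOccupied s).card : ℝ) : ℝ) : ℂ) := by push_cast; ring
    rw [e, Complex.ofReal_re]
  rw [hdiag] at h
  refine le_trans (Real.exp_le_exp.2 ?_) h
  have hcard : ((doublyOccupied s).card : ℝ) ≤ ((min p q : ℕ) : ℝ) := by
    exact_mod_cast card_doublyOccupied_le_min'' hs
  have h1 : (U + U') * ((doublyOccupied s).card : ℝ) ≤ max (U + U') 0 * ((min p q : ℕ) : ℝ) :=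
    calc (U + U') * ((doublyOccupied s).card : ℝ) ≤ max (U + U') 0 * ((doublyOccupied s).card : ℝ) :=
          mul_le_mul_of_nonneg_right (le_max_left _ _) (Nat.cast_nonneg _)
      _ ≤ max (U + U') 0 * ((min p q : ℕ) : ℝ) := mul_le_mul_of_nonneg_left hcard (le_max_right _ _)
  have h2 := mul_le_mul_of_nonneg_left h1 hβ
  linarith [h2, mul_assoc β (max (U + U') 0) (((min p q : ℕ) : ℝ))]

end Floor

/-! ### §2 The corner cut: two penalty-free cuts with one split each -/

section Corner

/-- Two decidability structures on the same adjacency give the same Hubbard Hamiltonian.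
[cite: LeBlancEtAl2015, eq. (1)] -/
private theorem hamiltonian_congr_graph {Λ : Type*} [LinearOrder Λ] [Fintype Λ] {G₁ G₂ : SimpleGraph Λ}
    [DecidableRel G₁.Adj] [DecidableRel G₂.Adj] (h : G₁ = G₂) (t U : ℝ) :
    hamiltonian G₁ t U = hamiltonian G₂ t U := by
  subst h
  congr!

/-- **One penalty-free cut along the major coordinate, one split of the particle numbers.** For any two bond sets
`G, G'` on `Fin (K + h) ×ₗ Fin B` (lower `K` rows, upper `h` rows; induced bond sets on both parts) and `β ≥ 0`:
`Re Z(lower; c, d) · Re Z(upper; q₁, q₂) ≤ Re Z(G, G'; c + q₁, d + q₂)` — one term of the summed cut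
`ThermodynamicLimit.partitionFn_twoGraph_sector_cut_sum_of_induced`. [cite: Ruelle1969, §3.3 (3.11)–(3.18)]
[cite: Israel1979, Lemma II.3.1] -/
theorem partitionFn_rowCut_single_le {K h B : ℕ} (G G' : SimpleGraph (Fin (K + h) ×ₗ Fin B)) [DecidableRel G.Adj]
    [DecidableRel G'.Adj] (t U t' U' : ℝ) {β : ℝ} (hβ : 0 ≤ β) (c d q₁ q₂ : ℕ) :
    (partitionFn β (spinSectorHamiltonian c d
        (hamiltonian (G.comap (rectCastAdd K h B)) t U + hamiltonian (G'.comap (rectCastAdd K h B)) t' U'))).re *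
      (partitionFn β (spinSectorHamiltonian q₁ q₂
        (hamiltonian (G.comap (rectNatAdd K h B)) t U + hamiltonian (G'.comap (rectNatAdd K h B)) t' U'))).re ≤
      (partitionFn β (spinSectorHamiltonian (c + q₁) (d + q₂) (hamiltonian G t U + hamiltonian G' t' U'))).re := by
  set e₁ : (Fin K ×ₗ Fin B) ↪ (Fin (K + h) ×ₗ Fin B) :=
    ⟨rectCastAdd K h B, (strictMono_rectCastAdd K h B).injective⟩ with he₁
  set e₂ : (Fin h ×ₗ Fin B) ↪ (Fin (K + h) ×ₗ Fin B) :=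
    ⟨rectNatAdd K h B, (strictMono_rectNatAdd K h B).injective⟩ with he₂
  have hT : ∀ q ∈ ({(q₁, q₂)} : Finset (ℕ × ℕ)), q.1 ≤ c + q₁ ∧ q.2 ≤ d + q₂ := by
    intro q hq
    rw [Finset.mem_singleton.1 hq]
    exact ⟨Nat.le_add_left _ _, Nat.le_add_left _ _⟩
  have hcut := partitionFn_twoGraph_sector_cut_sum_of_induced G G' (e₁ := e₁) (e₂ := e₂)
    (strictMono_rectCastAdd K h B) (strictMono_rectNatAdd K h B) (rectCastAdd_lt_rectNatAdd K h B)
    (rectCastAdd_cover K h B) t U t' U' hβ (c + q₁) (d + q₂) {(q₁, q₂)} hT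
  rw [Finset.sum_singleton] at hcut
  have hE₁ : (e₁ : Fin K ×ₗ Fin B → Fin (K + h) ×ₗ Fin B) = rectCastAdd K h B := rfl
  have hE₂ : (e₂ : Fin h ×ₗ Fin B → Fin (K + h) ×ₗ Fin B) = rectNatAdd K h B := rfl
  rw [hE₁, hE₂, Nat.add_sub_cancel, Nat.add_sub_cancel] at hcut
  exact hcut

/-- **THE CORNER CUT.** For any two bond sets `G, G'` on `Fin (K₁ + h) ×ₗ Fin (K₂ + w)` and `β ≥ 0`: the inner
rectangle `K₁ × K₂` (induced bonds, pulled back to `Fin K₁ ×ₗ Fin K₂`), the side strip `K₁ × w` (in swapped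
coordinates `Fin w ×ₗ Fin K₁`) and the top strip `h × (K₂ + w)` multiply below the whole:
`Re Z(inner; c, d) · Re Z(side; q₁, q₂) · Re Z(top; r₁, r₂) ≤ Re Z(G, G'; c + q₁ + r₁, d + q₂ + r₂)` (cut off the top
rows; swap; cut off the last `w` columns; swap back — each cut penalty-free with one split).
[cite: Ruelle1969, §3.3 (3.11)–(3.18)] [cite: Israel1979, Lemma II.3.1] -/
theorem partitionFn_corner_le (K₁ K₂ h w : ℕ) (G G' : SimpleGraph (Fin (K₁ + h) ×ₗ Fin (K₂ + w)))
    [DecidableRel G.Adj] [DecidableRel G'.Adj] (t U t' U' : ℝ) {β : ℝ} (hβ : 0 ≤ β) (c d q₁ q₂ r₁ r₂ : ℕ) :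
    (partitionFn β (spinSectorHamiltonian c d
        (hamiltonian (((((G.comap (rectCastAdd K₁ h (K₂ + w))).comap (rectSwap (K₂ + w) K₁)).comap
            (rectCastAdd K₂ w K₁)).comap (rectSwap K₁ K₂))) t U +
          hamiltonian (((((G'.comap (rectCastAdd K₁ h (K₂ + w))).comap (rectSwap (K₂ + w) K₁)).comap
            (rectCastAdd K₂ w K₁)).comap (rectSwap K₁ K₂))) t' U'))).re *
      (partitionFn β (spinSectorHamiltonian q₁ q₂
        (hamiltonian ((((G.comap (rectCastAdd K₁ h (K₂ + w))).comap (rectSwap (K₂ + w) K₁)).comap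
            (rectNatAdd K₂ w K₁))) t U +
          hamiltonian ((((G'.comap (rectCastAdd K₁ h (K₂ + w))).comap (rectSwap (K₂ + w) K₁)).comap
            (rectNatAdd K₂ w K₁))) t' U'))).re *
      (partitionFn β (spinSectorHamiltonian r₁ r₂
        (hamiltonian (G.comap (rectNatAdd K₁ h (K₂ + w))) t U +
          hamiltonian (G'.comap (rectNatAdd K₁ h (K₂ + w))) t' U'))).re ≤
      (partitionFn β (spinSectorHamiltonian (c + q₁ + r₁) (d + q₂ + r₂)
        (hamiltonian G t U + hamiltonian G' t' U'))).re := by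
  -- first cut: the top `h` rows
  have h1 := partitionFn_rowCut_single_le G G' t U t' U' hβ (c + q₁) (d + q₂) r₁ r₂
  -- second cut: swap the lower part and cut off its last `w` rows (= the last `w` columns)
  have h2 := partitionFn_rowCut_single_le ((G.comap (rectCastAdd K₁ h (K₂ + w))).comap (rectSwap (K₂ + w) K₁))
    ((G'.comap (rectCastAdd K₁ h (K₂ + w))).comap (rectSwap (K₂ + w) K₁)) t U t' U' hβ c d q₁ q₂
  rw [partitionFn_spinSector_twoGraph_comap_rectSwap] at h2
  -- swap the inner part back
  rw [← partitionFn_spinSector_twoGraph_comap_rectSwap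
    ((((G.comap (rectCastAdd K₁ h (K₂ + w))).comap (rectSwap (K₂ + w) K₁)).comap (rectCastAdd K₂ w K₁)))
    ((((G'.comap (rectCastAdd K₁ h (K₂ + w))).comap (rectSwap (K₂ + w) K₁)).comap (rectCastAdd K₂ w K₁)))] at h2
  have h0 : 0 ≤ (partitionFn β (spinSectorHamiltonian r₁ r₂
      (hamiltonian (G.comap (rectNatAdd K₁ h (K₂ + w))) t U +
        hamiltonian (G'.comap (rectNatAdd K₁ h (K₂ + w))) t' U'))).re :=
    partitionFn_spinSector_re_nonneg _ _ ((hamiltonian_isHermitian _ t U).add (hamiltonian_isHermitian _ t' U')) β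
  exact le_trans (mul_le_mul_of_nonneg_right h2 h0) h1

/-- **The corner cut on the `t–t'` torus with OPEN `a × b` boxes inside.** Torus `(K_x a + h) × (K_y b + w)` with
`K_x, K_y, h, w ≥ 1`, `β ≥ 0`; `P ∈ ℝ[ℕ × ℕ]` with `0 ≤ P(c,d) ≤ Re Z_β(H^open_{a×b}(t,t',U); c, d)` for all `(c,d)`;
border sectors `q ≤ w K_x a`, `r ≤ h (K_y b + w)` (componentwise). Then
`(P^{K_x K_y})(c,d) · e^{−β U⁺ min(q₁,q₂)} · e^{−β U⁺ min(r₁,r₂)} ≤ Re Z_β(H^torus; c + q₁ + r₁, d + q₂ + r₂)` — the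
blocks of the inner rectangle are open boxes of the torus (no wrap-around bond inside, `a < K_x a + h`,
`b < K_y b + w`), the sum over all assignments of box particle numbers with total `(c,d)` is the coefficient, and the
two border strips carry `q`, `r` at the crude floor. [cite: Ruelle1969, §3.3 (3.11)–(3.18)]
[cite: Israel1979, Lemma II.3.1] [cite: LeBlancEtAl2015, eq. (1)] -/
theorem coeff_pow_mul_exp_le_partitionFn_rectTorus_corner (a b Kx Ky h w : ℕ) (hKx : 1 ≤ Kx) (hKy : 1 ≤ Ky)
    (hh : 1 ≤ h) (hw : 1 ≤ w) (t t' U : ℝ) {β : ℝ} (hβ : 0 ≤ β) (P : AddMonoidAlgebra ℝ (ℕ × ℕ))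
    (hP0 : ∀ m, 0 ≤ P.coeff m)
    (hP : ∀ c d, P.coeff (c, d) ≤ (partitionFn β (spinSectorHamiltonian c d (hubbardOpenBoxTT' a b t t' U))).re)
    (c d : ℕ) {q₁ q₂ r₁ r₂ : ℕ} (hq₁ : q₁ ≤ w * (Kx * a)) (hq₂ : q₂ ≤ w * (Kx * a))
    (hr₁ : r₁ ≤ h * (Ky * b + w)) (hr₂ : r₂ ≤ h * (Ky * b + w)) :
    (P ^ (Kx * Ky)).coeff (c, d) * Real.exp (-(β * max U 0 * ((min q₁ q₂ : ℕ) : ℝ))) *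
        Real.exp (-(β * max U 0 * ((min r₁ r₂ : ℕ) : ℝ))) ≤
      (partitionFn β (spinSectorHamiltonian (c + q₁ + r₁) (d + q₂ + r₂)
        (hubbardRectTorusTT' (Kx * a + h) (Ky * b + w) t t' U))).re := by
  set G := fermionRectTorusGraph (Kx * a + h) (Ky * b + w) with hG
  set G' := fermionRectTorusDiagGraph (Kx * a + h) (Ky * b + w) with hG'
  have hcorner := partitionFn_corner_le (Kx * a) (Ky * b) h w G G' t U t' 0 hβ c d q₁ q₂ r₁ r₂
  -- the inner rectangle: its blocks are open `a × b` boxes of the torus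
  have ha : a < Kx * a + h := by nlinarith
  have hb : b < Ky * b + w := by nlinarith
  have hinner : (P ^ (Kx * Ky)).coeff (c, d) ≤ (partitionFn β (spinSectorHamiltonian c d
      (hamiltonian (((((G.comap (rectCastAdd (Kx * a) h (Ky * b + w))).comap (rectSwap (Ky * b + w) (Kx * a))).comap
          (rectCastAdd (Ky * b) w (Kx * a))).comap (rectSwap (Kx * a) (Ky * b)))) t U +
        hamiltonian (((((G'.comap (rectCastAdd (Kx * a) h (Ky * b + w))).comap (rectSwap (Ky * b + w) (Kx * a))).comap
          (rectCastAdd (Ky * b) w (Kx * a))).comap (rectSwap (Kx * a) (Ky * b)))) t' 0))).re := by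
    have hbl := coeff_prod_le_partitionFn_blocks a b t U t' 0 hβ Kx Ky (Kx * a) (Ky * b) rfl rfl
      (((((G.comap (rectCastAdd (Kx * a) h (Ky * b + w))).comap (rectSwap (Ky * b + w) (Kx * a))).comap
          (rectCastAdd (Ky * b) w (Kx * a))).comap (rectSwap (Kx * a) (Ky * b))))
      (((((G'.comap (rectCastAdd (Kx * a) h (Ky * b + w))).comap (rectSwap (Ky * b + w) (Kx * a))).comap
          (rectCastAdd (Ky * b) w (Kx * a))).comap (rectSwap (Kx * a) (Ky * b))))
      (fun _ _ => P) (fun _ _ => hP0) (fun i j c' d' => ?_) c d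
    · have e3 : (∏ _i : Fin Kx, ∏ _j : Fin Ky, P) = P ^ (Kx * Ky) := by
        simp only [Finset.prod_const, Finset.card_univ, Fintype.card_fin]
        rw [← pow_mul, mul_comm]
      rw [e3] at hbl
      exact hbl
    · -- block `(i, j)` sits at offset `(i a, j b)` in the torus
      have hf1 : ∀ p : Fin a ×ₗ Fin b, ((ofLex ((rectCastAdd (Kx * a) h (Ky * b + w) ∘ rectSwap (Ky * b + w) (Kx * a) ∘
          rectCastAdd (Ky * b) w (Kx * a) ∘ rectSwap (Kx * a) (Ky * b) ∘ blockEmb (rfl : Kx * a = Kx * a)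
            (rfl : Ky * b = Ky * b) i j) p)).1 : ℕ) = (i : ℕ) * a + (ofLex p).1 := fun p => rfl
      have hf2 : ∀ p : Fin a ×ₗ Fin b, ((ofLex ((rectCastAdd (Kx * a) h (Ky * b + w) ∘ rectSwap (Ky * b + w) (Kx * a) ∘
          rectCastAdd (Ky * b) w (Kx * a) ∘ rectSwap (Kx * a) (Ky * b) ∘ blockEmb (rfl : Kx * a = Kx * a)
            (rfl : Ky * b = Ky * b) i j) p)).2 : ℕ) = (j : ℕ) * b + (ofLex p).2 := fun p => rfl
      have hB : (((((G.comap (rectCastAdd (Kx * a) h (Ky * b + w))).comap (rectSwap (Ky * b + w) (Kx * a))).comap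
          (rectCastAdd (Ky * b) w (Kx * a))).comap (rectSwap (Kx * a) (Ky * b))).comap
            (blockEmb (rfl : Kx * a = Kx * a) (rfl : Ky * b = Ky * b) i j)) = rectBoxGraph a b := by
        simp only [SimpleGraph.comap_comap, hG]
        exact comap_fermionRectTorusGraph_eq_rectBoxGraph_of_offset ha hb _ _ _ hf1 hf2
      have hB' : (((((G'.comap (rectCastAdd (Kx * a) h (Ky * b + w))).comap (rectSwap (Ky * b + w) (Kx * a))).comap
          (rectCastAdd (Ky * b) w (Kx * a))).comap (rectSwap (Kx * a) (Ky * b))).comap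
            (blockEmb (rfl : Kx * a = Kx * a) (rfl : Ky * b = Ky * b) i j)) = rectBoxDiagGraph a b := by
        simp only [SimpleGraph.comap_comap, hG']
        exact comap_fermionRectTorusDiagGraph_eq_rectBoxDiagGraph_of_offset ha hb _ _ _ hf1 hf2
      rw [hamiltonian_congr_graph hB, hamiltonian_congr_graph hB']
      exact hP c' d'
  -- the two border strips at the crude floor
  have hside := exp_neg_le_partitionFn_spinSector_twoGraph
    ((((G.comap (rectCastAdd (Kx * a) h (Ky * b + w))).comap (rectSwap (Ky * b + w) (Kx * a))).comap
        (rectNatAdd (Ky * b) w (Kx * a))))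
    ((((G'.comap (rectCastAdd (Kx * a) h (Ky * b + w))).comap (rectSwap (Ky * b + w) (Kx * a))).comap
        (rectNatAdd (Ky * b) w (Kx * a)))) t U t' 0 hβ (p := q₁) (q := q₂)
    (by rw [card_rectSites]; exact hq₁) (by rw [card_rectSites]; exact hq₂)
  have htop := exp_neg_le_partitionFn_spinSector_twoGraph (G.comap (rectNatAdd (Kx * a) h (Ky * b + w)))
    (G'.comap (rectNatAdd (Kx * a) h (Ky * b + w))) t U t' 0 hβ (p := r₁) (q := r₂)
    (by rw [card_rectSites]; exact hr₁) (by rw [card_rectSites]; exact hr₂)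
  rw [add_zero] at hside htop
  have hP0' : 0 ≤ (P ^ (Kx * Ky)).coeff (c, d) := coeff_pow_nonneg_of_nonneg hP0 _ _
  have hZ0 : ∀ {Λ : Type} [LinearOrder Λ] [Fintype Λ] (H H' : SimpleGraph Λ) [DecidableRel H.Adj]
      [DecidableRel H'.Adj] (x y : ℕ),
      0 ≤ (partitionFn β (spinSectorHamiltonian x y (hamiltonian H t U + hamiltonian H' t' 0))).re := by
    intro Λ _ _ H H' _ _ x y
    exact partitionFn_spinSector_re_nonneg _ _
      ((hamiltonian_isHermitian _ t U).add (hamiltonian_isHermitian _ t' 0)) β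
  calc (P ^ (Kx * Ky)).coeff (c, d) * Real.exp (-(β * max U 0 * ((min q₁ q₂ : ℕ) : ℝ))) *
        Real.exp (-(β * max U 0 * ((min r₁ r₂ : ℕ) : ℝ)))
      ≤ _ * _ * _ := mul_le_mul (mul_le_mul hinner hside (Real.exp_pos _).le (hZ0 _ _ _ _)) htop
          (Real.exp_pos _).le (mul_nonneg (hZ0 _ _ _ _) (hZ0 _ _ _ _))
    _ ≤ _ := hcorner

end Corner

/-! ### §4 Every large torus: the type-class floor with an `O(L)` defect, and the thermodynamic limit -/

section AllTori

/-- **The type-class (C2) floor on EVERY large torus, finite volume, `O(L) + O(log L)` defect.** Data: an open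
`a × b` box (`a, b ≥ 1`), a finite set `S` of box spin sectors, a balanced base type `m` supported in `S`
(`Σ_s m_s = q ≥ 1`, `Σ_s m_s a_s = Σ_s m_s b_s = A₀`) of density `n = 2A₀/(q a b) ≤ 2`, certified floors
`0 < z_s ≤ Re Z_β(H^open_{a×b}(t,t',U); s)` (`β ≥ 0`). Then for every `L ≥ q a + 1`, `L ≥ b + 1`, with
`W = (q log q − Σ_s m_s log m_s + Σ_s m_s log z_s)/(q a b)`:
`W·L² − (|W| + β U⁺)(q a + b)·L − |S|·log(L² + 1) ≤ log Re Z_β(sectorHamiltonianTT' t t' U n L)`.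
Construction: inner rectangle `K₁ × K₂`, `K₁ = q a ⌊(L−1)/(qa)⌋`, `K₂ = b ⌊(L−1)/b⌋`, carrying `R = K₁K₂/(qab)`
copies of the type (method of types for the mixing entropy); the `L² − K₁K₂ ≤ (qa + b) L` border sites carry the
remaining `halfRectN n L − R A₀ ≤ L² − K₁ K₂` electrons per spin at the crude floor `e^{−βU⁺}` per electron.
[cite: Ruelle1969, §3.3 (3.11)–(3.18)] [cite: Israel1979, Lemma II.3.1] [cite: CoverThomas2006, Theorem 11.1.3] -/
theorem typeFreeEntropy_mul_sq_sub_linear_le_log_partitionFn (t t' U n : ℝ) {β : ℝ} (hβ : 0 ≤ β)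
    {a b : ℕ} (ha : 1 ≤ a) (hb : 1 ≤ b) (S : Finset (ℕ × ℕ)) (m : ℕ × ℕ → ℕ) {q A₀ : ℕ} (hq : 1 ≤ q)
    (hmS : ∀ s, m s ≠ 0 → s ∈ S) (hsum : ∑ s ∈ S, m s = q) (hA : ∑ s ∈ S, m s * s.1 = A₀)
    (hB : ∑ s ∈ S, m s * s.2 = A₀) (hn : n * ((q : ℝ) * a * b) = 2 * A₀) (hn2 : n ≤ 2)
    {z : ℕ × ℕ → ℝ} (hz0 : ∀ s ∈ S, 0 < z s)
    (hz : ∀ s ∈ S, z s ≤ (partitionFn β (spinSectorHamiltonian s.1 s.2 (hubbardOpenBoxTT' a b t t' U))).re)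
    {L : ℕ} (hLa : q * a + 1 ≤ L) (hLb : b + 1 ≤ L) :
    ((q : ℝ) * Real.log q - ∑ s ∈ S, (m s : ℝ) * Real.log (m s) + ∑ s ∈ S, (m s : ℝ) * Real.log (z s)) /
          ((q : ℝ) * a * b) * (L : ℝ) ^ 2 -
        (|((q : ℝ) * Real.log q - ∑ s ∈ S, (m s : ℝ) * Real.log (m s) + ∑ s ∈ S, (m s : ℝ) * Real.log (z s)) /
            ((q : ℝ) * a * b)| + β * max U 0) * ((q * a + b : ℕ) : ℝ) * L -
        S.card * Real.log ((L : ℝ) ^ 2 + 1) ≤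
      Real.log (partitionFn β (sectorHamiltonianTT' t t' U n L)).re := by
  classical
  /- 1. integer geometry (all nonlinear integer terms are named, so that `omega` sees atoms) -/
  have hq0 : 0 < q := hq
  have hqa : 0 < q * a := Nat.mul_pos hq0 ha
  obtain ⟨Kx', hKx'⟩ : ∃ K, K = (L - 1) / (q * a) := ⟨_, rfl⟩
  obtain ⟨Ky, hKy⟩ : ∃ K, K = (L - 1) / b := ⟨_, rfl⟩
  obtain ⟨QA, hQA⟩ : ∃ Q, Q = q * a := ⟨_, rfl⟩
  obtain ⟨M₁, hM₁⟩ : ∃ M, M = (L - 1) % (q * a) := ⟨_, rfl⟩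
  obtain ⟨M₂, hM₂⟩ : ∃ M, M = (L - 1) % b := ⟨_, rfl⟩
  obtain ⟨K₁, hK₁⟩ : ∃ K, K = q * Kx' * a := ⟨_, rfl⟩
  obtain ⟨K₂, hK₂⟩ : ∃ K, K = Ky * b := ⟨_, rfl⟩
  have hdm1 : K₁ + M₁ = L - 1 := by
    rw [hK₁, hM₁, hKx', Nat.mul_right_comm]; exact Nat.div_add_mod (L - 1) (q * a)
  have hm1 : M₁ < QA := by rw [hM₁, hQA]; exact Nat.mod_lt _ hqa
  have hdm2 : K₂ + M₂ = L - 1 := by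
    rw [hK₂, hM₂, hKy, Nat.mul_comm]; exact Nat.div_add_mod (L - 1) b
  have hm2 : M₂ < b := by rw [hM₂]; exact Nat.mod_lt _ (by omega)
  have hQAL : QA + 1 ≤ L := by rw [hQA]; exact hLa
  have hKx'1 : 1 ≤ Kx' := by rw [hKx']; exact Nat.div_pos (by omega) hqa
  have hKy1 : 1 ≤ Ky := by rw [hKy]; exact Nat.div_pos (by omega) (by omega)
  clear hKx' hKy hM₁ hM₂
  obtain ⟨h, hh⟩ : ∃ h', h' = L - K₁ := ⟨_, rfl⟩
  obtain ⟨w, hw⟩ : ∃ w', w' = L - K₂ := ⟨_, rfl⟩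
  have hh1 : 1 ≤ h := by omega
  have hhle : h ≤ QA := by omega
  have hw1 : 1 ≤ w := by omega
  have hwle : w ≤ b := by omega
  have e1 : K₁ + h = L := by omega
  have e2 : K₂ + w = L := by omega
  clear hh hw hdm1 hm1 hdm2 hm2
  have hKx1 : 1 ≤ q * Kx' := le_trans hq (Nat.le_mul_of_pos_right q hKx'1)
  -- real forms
  have e1R : (K₁ : ℝ) + h = L := by exact_mod_cast e1
  have e2R : (K₂ : ℝ) + w = L := by exact_mod_cast e2
  have hK₁R : (K₁ : ℝ) = q * Kx' * a := by rw [hK₁]; push_cast; ring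
  have hK₂R : (K₂ : ℝ) = Ky * b := by rw [hK₂]; push_cast; ring
  have hhR : (h : ℝ) ≤ q * a := by
    have : (h : ℝ) ≤ QA := by exact_mod_cast hhle
    rw [hQA] at this; push_cast at this; exact this
  have hwR : (w : ℝ) ≤ b := by exact_mod_cast hwle
  have hh0 : (0 : ℝ) ≤ h := Nat.cast_nonneg h
  have hw0 : (0 : ℝ) ≤ w := Nat.cast_nonneg w
  have hK₁0 : (0 : ℝ) ≤ K₁ := Nat.cast_nonneg K₁
  have hK₂0 : (0 : ℝ) ≤ K₂ := Nat.cast_nonneg K₂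
  have hL0 : (0 : ℝ) ≤ L := Nat.cast_nonneg L
  have hK₁L : (K₁ : ℝ) ≤ L := by linarith
  have hK₂L : (K₂ : ℝ) ≤ L := by linarith
  -- border identity and bounds
  have hborder : (L : ℝ) ^ 2 - K₁ * K₂ = w * K₁ + h * L := by
    linear_combination (-(L : ℝ)) * e1R + (-(K₁ : ℝ)) * e2R
  have hborder_le : (L : ℝ) ^ 2 - K₁ * K₂ ≤ ((q * a + b : ℕ) : ℝ) * L := by
    rw [hborder]; push_cast
    have h1 : (w : ℝ) * K₁ ≤ w * L := mul_le_mul_of_nonneg_left hK₁L hw0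
    have h2 : (w : ℝ) * L ≤ b * L := mul_le_mul_of_nonneg_right hwR hL0
    have h3 : (h : ℝ) * L ≤ q * a * L := mul_le_mul_of_nonneg_right hhR hL0
    linarith
  have hK₁K₂le : (K₁ : ℝ) * K₂ ≤ (L : ℝ) ^ 2 := by
    rw [sq]; exact mul_le_mul hK₁L hK₂L hK₂0 hL0
  have hbord0 : 0 ≤ (L : ℝ) ^ 2 - K₁ * K₂ := sub_nonneg.2 hK₁K₂le
  /- 2. the type and its density -/
  obtain ⟨R, hR⟩ : ∃ R', R' = Kx' * Ky := ⟨_, rfl⟩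
  have hK : q * Kx' * Ky = R * q := by rw [hR]; ring
  have hRqab : (R : ℝ) * q * a * b = K₁ * K₂ := by rw [hK₁R, hK₂R, hR]; push_cast; ring
  have hqabpos : (0 : ℝ) < (q : ℝ) * a * b := by
    have : (0 : ℝ) < q := by exact_mod_cast hq0
    have : (0 : ℝ) < a := by exact_mod_cast ha
    have : (0 : ℝ) < b := by exact_mod_cast hb
    positivity
  have hA₀0 : (0 : ℝ) ≤ A₀ := Nat.cast_nonneg A₀
  have hn0 : 0 ≤ n := le_of_mul_le_mul_right (by rw [zero_mul, hn]; positivity) hqabpos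
  have hRA : ((R * A₀ : ℕ) : ℝ) = n / 2 * (K₁ * K₂) := by
    rw [← hRqab]; push_cast
    linear_combination (-((R : ℝ) / 2)) * hn
  -- the type part fits below the canonical sector, the remainder fits into the border
  obtain ⟨kL, hkL⟩ : ∃ k, k = halfRectN n L := ⟨_, rfl⟩
  have hRAle : R * A₀ ≤ kL := by
    rw [hkL]
    unfold halfRectN
    refine Nat.le_floor ?_
    rw [hRA]
    have := mul_le_mul_of_nonneg_left hK₁K₂le (by linarith : 0 ≤ n / 2)
    linarith
  have hδ0 : (kL : ℝ) ≤ n * (L : ℝ) ^ 2 / 2 := by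
    rw [hkL]; unfold halfRectN; exact Nat.floor_le (by positivity)
  obtain ⟨ρ, hρ⟩ : ∃ ρ', ρ' = kL - R * A₀ := ⟨_, rfl⟩
  have hρsum : R * A₀ + ρ = kL := by omega
  have hρR : (ρ : ℝ) = (kL : ℝ) - ((R * A₀ : ℕ) : ℝ) := by
    have : ((R * A₀ : ℕ) : ℝ) + ρ = kL := by exact_mod_cast hρsum
    linarith
  have hρle : (ρ : ℝ) ≤ (L : ℝ) ^ 2 - K₁ * K₂ := by
    rw [hρR, hRA]
    have := mul_le_mul_of_nonneg_right (show n / 2 ≤ 1 by linarith) hbord0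
    linarith
  have hρleN : ρ ≤ w * K₁ + h * L := by
    have : (ρ : ℝ) ≤ w * K₁ + h * L := hρle.trans (le_of_eq hborder)
    exact_mod_cast this
  obtain ⟨q₁, hq₁⟩ : ∃ q', q' = min ρ (w * K₁) := ⟨_, rfl⟩
  obtain ⟨r₁, hr₁⟩ : ∃ r', r' = ρ - q₁ := ⟨_, rfl⟩
  have hq₁le : q₁ ≤ w * (q * Kx' * a) := by rw [hq₁, ← hK₁]; exact min_le_right _ _
  have hq₁ρ : q₁ ≤ ρ := by rw [hq₁]; exact min_le_left _ _
  have hr₁le : r₁ ≤ h * (Ky * b + w) := by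
    rw [← hK₂, e2, hr₁]
    rcases le_total ρ (w * K₁) with hc | hc
    · rw [hq₁, min_eq_left hc, Nat.sub_self]; exact Nat.zero_le _
    · rw [hq₁, min_eq_right hc]; omega
  have hsec : R * A₀ + q₁ + r₁ = kL := by omega
  have hρq : (q₁ : ℝ) + r₁ = ρ := by
    have : q₁ + r₁ = ρ := by omega
    exact_mod_cast this
  clear hρ hr₁ hq₁
  /- 3. the generating polynomial of the certified box data -/
  set P : AddMonoidAlgebra ℝ (ℕ × ℕ) := ∑ s ∈ S, single s (z s) with hPdef
  have hPcoeff : ∀ c : ℕ × ℕ, P.coeff c = if c ∈ S then z c else 0 := by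
    intro c
    rw [hPdef, coeff_sum, Finset.sum_apply']
    simp_rw [coeff_single, Finsupp.single_apply]
    rw [Finset.sum_ite_eq' S c]
  have hP0 : ∀ c, 0 ≤ P.coeff c := by
    intro c
    rw [hPcoeff]
    split_ifs with hc
    · exact (hz0 c hc).le
    · exact le_rfl
  have hPle : ∀ c d, P.coeff (c, d) ≤
      (partitionFn β (spinSectorHamiltonian c d (hubbardOpenBoxTT' a b t t' U))).re := by
    intro c d
    rw [hPcoeff]
    split_ifs with hc
    · exact hz (c, d) hc
    · exact partitionFn_spinSector_re_nonneg _ _ (hubbardOpenBoxTT'_isHermitian a b t t' U) β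
  -- the type `R • m`
  have hk : (fun s => R * m s) ∈ S.piAntidiag (q * Kx' * Ky) := by
    rw [Finset.mem_piAntidiag]
    refine ⟨?_, fun s hs => hmS s (fun h0 => hs (by rw [h0, mul_zero]))⟩
    rw [← Finset.mul_sum, hsum, hK]
  have htarget : (∑ s ∈ S, (R * m s) • (s : ℕ × ℕ)) = (R * A₀, R * A₀) := by
    refine Prod.ext ?_ ?_
    · rw [Prod.fst_sum]
      show ∑ s ∈ S, ((R * m s) • s).1 = R * A₀
      simp_rw [Prod.smul_fst, smul_eq_mul]
      rw [← hA, Finset.mul_sum]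
      exact Finset.sum_congr rfl fun s _ => by ring
    · rw [Prod.snd_sum]
      show ∑ s ∈ S, ((R * m s) • s).2 = R * A₀
      simp_rw [Prod.smul_snd, smul_eq_mul]
      rw [← hB, Finset.mul_sum]
      exact Finset.sum_congr rfl fun s _ => by ring
  have hcoeff := le_coeff_pow_of_type S (fun s => s) z (fun s hs => (hz0 s hs).le) hk
  rw [htarget] at hcoeff
  /- 4. the corner cut on the torus `L × L = (q Kx' a + h) × (Ky b + w)` -/
  have hC := coeff_pow_mul_exp_le_partitionFn_rectTorus_corner a b (q * Kx') Ky h w hKx1 hKy1 hh1 hw1 t t' U hβ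
    P hP0 hPle (R * A₀) (R * A₀) hq₁le hq₁le hr₁le hr₁le
  rw [min_self, min_self, hsec] at hC
  have hL1 : q * Kx' * a + h = L := by rw [← hK₁]; exact e1
  have hL2 : Ky * b + w = L := by rw [← hK₂]; exact e2
  have hsq : Real.log (partitionFn β (spinSectorHamiltonian kL kL
      (hubbardRectTorusTT' (q * Kx' * a + h) (Ky * b + w) t t' U))).re =
      Real.log (partitionFn β (sectorHamiltonianTT' t t' U n L)).re := by
    rw [partitionFn_sectorHamiltonianTT'_eq_spinSector, partitionFn_spinSector_hubbardTorusTT'_eq_rect, hL1, hL2,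
      hkL]
  /- 5. logarithms -/
  have hmult : (0 : ℝ) < Nat.multinomial S (fun s => R * m s) := by exact_mod_cast Nat.multinomial_pos S _
  have hprod : (0 : ℝ) < ∏ s ∈ S, z s ^ (R * m s) := Finset.prod_pos fun s hs => pow_pos (hz0 s hs) _
  have hcoeffpos : 0 < (P ^ (q * Kx' * Ky)).coeff (R * A₀, R * A₀) := lt_of_lt_of_le (mul_pos hmult hprod) hcoeff
  have hLHSpos : 0 < (P ^ (q * Kx' * Ky)).coeff (R * A₀, R * A₀) * Real.exp (-(β * max U 0 * (q₁ : ℝ))) *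
      Real.exp (-(β * max U 0 * (r₁ : ℝ))) := by positivity
  have hlogZ := Real.log_le_log hLHSpos hC
  rw [Real.log_mul (by positivity) (Real.exp_pos _).ne', Real.log_mul hcoeffpos.ne' (Real.exp_pos _).ne',
    Real.log_exp, Real.log_exp, hsq] at hlogZ
  -- the type term
  have hlogcoeff := Real.log_le_log (mul_pos hmult hprod) hcoeff
  rw [Real.log_mul hmult.ne' hprod.ne', Real.log_prod (fun s hs => (pow_pos (hz0 s hs) _).ne')] at hlogcoeff
  rw [Finset.sum_congr rfl fun s _ => Real.log_pow _ _] at hlogcoeff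
  have hKK1 : 1 ≤ q * Kx' * Ky := Nat.mul_pos (Nat.mul_pos hq0 hKx'1) hKy1
  have htype := typeEntropy_sub_le_log_multinomial S hKK1 hk
  rw [hK, InfVolFermionState.typeEntropy_smul S m hsum R] at htype
  have hzsum : ∑ s ∈ S, ((R * m s : ℕ) : ℝ) * Real.log (z s) = (R : ℝ) * ∑ s ∈ S, (m s : ℝ) * Real.log (z s) := by
    rw [Finset.mul_sum]; exact Finset.sum_congr rfl fun s _ => by push_cast; ring
  rw [hzsum] at hlogcoeff
  /- 6. bookkeeping -/
  set T : ℝ := (q : ℝ) * Real.log q - ∑ s ∈ S, (m s : ℝ) * Real.log (m s) with hT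
  set Zs : ℝ := ∑ s ∈ S, (m s : ℝ) * Real.log (z s) with hZs
  set W : ℝ := (T + Zs) / ((q : ℝ) * a * b) with hW
  have hWK : W * ((K₁ : ℝ) * K₂) = (R : ℝ) * T + (R : ℝ) * Zs := by
    rw [hW, ← hRqab]; field_simp
  have hU0 : 0 ≤ β * max U 0 := mul_nonneg hβ (le_max_right _ _)
  have hD1 : W * ((L : ℝ) ^ 2 - K₁ * K₂) ≤ |W| * (((q * a + b : ℕ) : ℝ) * L) :=
    calc W * ((L : ℝ) ^ 2 - K₁ * K₂) ≤ |W| * ((L : ℝ) ^ 2 - K₁ * K₂) :=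
          mul_le_mul_of_nonneg_right (le_abs_self W) hbord0
      _ ≤ |W| * (((q * a + b : ℕ) : ℝ) * L) := mul_le_mul_of_nonneg_left hborder_le (abs_nonneg W)
  have hD2 : β * max U 0 * ((q₁ : ℝ) + r₁) ≤ β * max U 0 * (((q * a + b : ℕ) : ℝ) * L) := by
    rw [hρq]
    exact mul_le_mul_of_nonneg_left (hρle.trans hborder_le) hU0
  have hD3 : (S.card : ℝ) * Real.log (((R * q : ℕ) : ℝ) + 1) ≤ S.card * Real.log ((L : ℝ) ^ 2 + 1) := by
    refine mul_le_mul_of_nonneg_left (Real.log_le_log (by positivity) ?_) (Nat.cast_nonneg _)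
    have ha1 : (1 : ℝ) ≤ a := by exact_mod_cast ha
    have hb1 : (1 : ℝ) ≤ b := by exact_mod_cast hb
    have hab1 : (1 : ℝ) ≤ (a : ℝ) * b := one_le_mul_of_one_le_of_one_le ha1 hb1
    have hR0 : (0 : ℝ) ≤ (R : ℝ) * q := by positivity
    have h1 : ((R * q : ℕ) : ℝ) ≤ (R : ℝ) * q * a * b := by
      push_cast
      calc (R : ℝ) * q = R * q * 1 := by ring
        _ ≤ R * q * ((a : ℝ) * b) := mul_le_mul_of_nonneg_left hab1 hR0
        _ = R * q * a * b := by ring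
    linarith
  have key : W * (L : ℝ) ^ 2 = (R : ℝ) * T + (R : ℝ) * Zs + W * ((L : ℝ) ^ 2 - K₁ * K₂) := by
    rw [← hWK]; ring
  show W * (L : ℝ) ^ 2 - (|W| + β * max U 0) * ((q * a + b : ℕ) : ℝ) * L -
      S.card * Real.log ((L : ℝ) ^ 2 + 1) ≤ Real.log (partitionFn β (sectorHamiltonianTT' t t' U n L)).re
  linarith [hlogZ, hlogcoeff, htype, key, hD1, hD2, hD3]

/-- **The certified C2 LOWER bound on the sector pressure along EVERY `Ls → ∞`** (thermal convention of record;
the all-tori version of `InfVolFermionState.eventually_typeFreeEntropy_mul_sq_le_log_partitionFn`, hypothesis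
`hbox` removed). Box `a × b` (`a, b ≥ 1`), sectors `S`, balanced base type `m` supported in `S` (`Σ m_s = q ≥ 1`,
`Σ m_s a_s = Σ m_s b_s = A₀`) of density `n = 2A₀/(q a b) ≤ 2`, floors `0 < z_s ≤ Re Z_β(H^open_{a×b}(t,t',U); s)`
(`β ≥ 0`). Then for every `ε > 0`, eventually along ANY `Ls → ∞`:
`(W − ε)·(Ls j)² ≤ log Re Z_β(sectorHamiltonianTT' t t' U n (Ls j))`,
`W = (q log q − Σ_s m_s log m_s + Σ_s m_s log z_s)/(q a b)` — the pressure-floor input `hW`/`hℓ` of the `T > 0`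
readers (`HubbardThermalAxisWindow`, `TorusSectorGibbsEntropyRowPressureInput`) for the FULL class of torus limits.
[cite: Ruelle1969, §3.3 (3.11)–(3.18)] [cite: Israel1979, Lemma II.3.1] [cite: CoverThomas2006, Theorem 11.1.3] -/
theorem InfVolFermionState.eventually_typeFreeEntropy_mul_sq_le_log_partitionFn_allTori (t t' U n : ℝ) {β : ℝ}
    (hβ : 0 ≤ β) {a b : ℕ} (ha : 1 ≤ a) (hb : 1 ≤ b) (S : Finset (ℕ × ℕ)) (m : ℕ × ℕ → ℕ) {q A₀ : ℕ}
    (hq : 1 ≤ q) (hmS : ∀ s, m s ≠ 0 → s ∈ S) (hsum : ∑ s ∈ S, m s = q) (hA : ∑ s ∈ S, m s * s.1 = A₀)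
    (hB : ∑ s ∈ S, m s * s.2 = A₀) (hn : n * ((q : ℝ) * a * b) = 2 * A₀) (hn2 : n ≤ 2)
    {z : ℕ × ℕ → ℝ} (hz0 : ∀ s ∈ S, 0 < z s)
    (hz : ∀ s ∈ S, z s ≤ (partitionFn β (spinSectorHamiltonian s.1 s.2 (hubbardOpenBoxTT' a b t t' U))).re)
    {Ls : ℕ → ℕ} (hLs : Tendsto Ls atTop atTop) {ε : ℝ} (hε : 0 < ε) :
    ∀ᶠ j in atTop, (((q : ℝ) * Real.log q - ∑ s ∈ S, (m s : ℝ) * Real.log (m s) +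
        ∑ s ∈ S, (m s : ℝ) * Real.log (z s)) / ((q : ℝ) * a * b) - ε) * (Ls j : ℝ) ^ 2 ≤
      Real.log (partitionFn β (sectorHamiltonianTT' t t' U n (Ls j))).re := by
  set W : ℝ := ((q : ℝ) * Real.log q - ∑ s ∈ S, (m s : ℝ) * Real.log (m s) +
    ∑ s ∈ S, (m s : ℝ) * Real.log (z s)) / ((q : ℝ) * a * b) with hW
  -- the `|S| log(L² + 1)` term is `≤ (ε/2) L²` eventually (`log x = o(x)`)
  have hε2 : 0 < ε / 2 := by linarith
  have hev : ∀ᶠ j in atTop, (S.card : ℝ) * Real.log ((Ls j : ℝ) ^ 2 + 1) ≤ ε / 2 * (Ls j : ℝ) ^ 2 := by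
    have h2 : Tendsto (fun j => (Ls j : ℝ) ^ 2 + 1) atTop atTop := tendsto_atTop_add_const_right _ 1
      ((tendsto_pow_atTop two_ne_zero).comp (tendsto_natCast_atTop_atTop.comp hLs))
    set c : ℝ := (ε / 2) / (2 * S.card + 1) with hc
    have hcpos : 0 < c := by positivity
    have h3 := h2.eventually (Real.isLittleO_log_id_atTop.def hcpos)
    filter_upwards [h3, hLs.eventually_ge_atTop 1] with j hj hj1
    have hL1 : (1 : ℝ) ≤ (Ls j : ℝ) ^ 2 := by nlinarith [show (1 : ℝ) ≤ Ls j by exact_mod_cast hj1]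
    have hpos : 0 < (Ls j : ℝ) ^ 2 + 1 := by positivity
    have hlogle : Real.log ((Ls j : ℝ) ^ 2 + 1) ≤ c * ((Ls j : ℝ) ^ 2 + 1) := by
      rwa [id, Real.norm_eq_abs, Real.norm_eq_abs, abs_of_nonneg (Real.log_nonneg (by linarith)),
        abs_of_pos hpos] at hj
    have hS : (0 : ℝ) ≤ S.card := Nat.cast_nonneg _
    have h5 : (S.card : ℝ) * ((Ls j : ℝ) ^ 2 + 1) ≤ (2 * S.card + 1) * (Ls j : ℝ) ^ 2 := by nlinarith
    calc (S.card : ℝ) * Real.log ((Ls j : ℝ) ^ 2 + 1) ≤ S.card * (c * ((Ls j : ℝ) ^ 2 + 1)) :=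
          mul_le_mul_of_nonneg_left hlogle hS
      _ = c * ((S.card : ℝ) * ((Ls j : ℝ) ^ 2 + 1)) := by ring
      _ ≤ c * ((2 * S.card + 1) * (Ls j : ℝ) ^ 2) := mul_le_mul_of_nonneg_left h5 hcpos.le
      _ = ε / 2 * (Ls j : ℝ) ^ 2 := by
          rw [hc]
          field_simp
  -- the linear term is `≤ (ε/2) L²` for `L ≥ 2 C/ε`
  set C : ℝ := (|W| + β * max U 0) * ((q * a + b : ℕ) : ℝ) with hC
  have hC0 : 0 ≤ C := by
    have : 0 ≤ β * max U 0 := mul_nonneg hβ (le_max_right _ _)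
    positivity
  filter_upwards [hev, hLs.eventually_ge_atTop (max (q * a + 1) (max (b + 1) ⌈2 * C / ε⌉₊))] with j hjε hj
  have hLa : q * a + 1 ≤ Ls j := le_trans (le_max_left _ _) hj
  have hLb : b + 1 ≤ Ls j := le_trans ((le_max_left _ _).trans (le_max_right _ _)) hj
  have hLc : (⌈2 * C / ε⌉₊ : ℝ) ≤ Ls j := by
    exact_mod_cast le_trans ((le_max_right _ _).trans (le_max_right _ _)) hj
  have hLC : 2 * C / ε ≤ Ls j := le_trans (Nat.le_ceil _) hLc
  rw [div_le_iff₀ hε] at hLC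
  have hfin := typeFreeEntropy_mul_sq_sub_linear_le_log_partitionFn t t' U n hβ ha hb S m hq hmS hsum hA hB hn hn2
    hz0 hz hLa hLb
  have hL0 : (0 : ℝ) ≤ Ls j := Nat.cast_nonneg _
  have hlin : C * (Ls j : ℝ) ≤ ε / 2 * (Ls j : ℝ) ^ 2 := by nlinarith
  have e : (W - ε) * (Ls j : ℝ) ^ 2 = W * (Ls j : ℝ) ^ 2 - ε / 2 * (Ls j : ℝ) ^ 2 - ε / 2 * (Ls j : ℝ) ^ 2 := by ring
  rw [e]
  have hfin' : W * (Ls j : ℝ) ^ 2 - C * (Ls j : ℝ) - S.card * Real.log ((Ls j : ℝ) ^ 2 + 1) ≤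
      Real.log (partitionFn β (sectorHamiltonianTT' t t' U n (Ls j))).re := by
    have := hfin; rw [hC]; linarith [this]
  linarith [hfin', hlin, hjε]

end AllTori


end Literature.MathematicalPhysics.QuantumLattice

end
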